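import Summits.ValiantsHypothesis.ValiantsHypothesis.Theorems.NewtonUnitEquationsTwoProductsMomentRecordLetters

/-!
# R12 rung — RECORD LETTERS ARE FREE, part 2/3: the record-letter BOUND (≤ 4m per weight) and the CELLS of the real weight plane
# (crux `NewtonUnitEquations.TwoProducts` = stmt-ValiantsHypothesis-5906; Theorems-side TRANSPLANT of val-idea-37 g4's kernel-proved workfile)

TRANSPLANT NOTE.  Second half of §2 (record-letter bound) and the first half of the «CLASS COUNT» section (cells) of
`Cruxes/TwoProducts/RecordLettersFree_val_idea_37_g4.lean` rev 4 @432a5af19a71 (sha16 4032ebb8ee1772ab; 0 `sorry`; std axioms; evidence #54 on 5906;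
crit-8 VERDICT #17 ★★ / GO 22:36:40Z) VERBATIM BY NAME, namespace `ValIdea37g4` → `…TwoProducts.MomentRecord`, importing part 1 (`…MomentRecordLetters`);
one-line docstrings added where the scratch had none; the 3-file split is for the 400-line cap only.  Content: `recordLetters`, `RecordLetterBound[Used]`,
`finrank_pencilSpace`, `recordLetterBound[Used]_of_weak`, `recordLetterBound[Used]_holds` (≤ `4m` record letters per weight); `critVal`/`critSet`/
`cellOf`/`cellSet` (cells of `{ξ·(x_a − x_b) = 0} ∪ {ξ·d = 0}` for REAL weights, both signs; `card_cellSet_le : ≤ 32(n²+1)`), the transfer lemmas and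
★ `wt_le_wt_iff_of_cellOf_eq` / `cost_le_cost_iff_of_cellOf_eq` (ONE representative cost order per cell — the ℝ/two-signed port of lead c3's
`DissocCount` cell lemmas).  Part 3 (`…MomentRecordCount.lean`) finishes: letters per cell, candidates, ★★ `momentRecordLawUsed_holds`, `momentRecordLaw_holds`.
Desk val-lit g14 RULING #356 (hand val-port-3 g3); `--supports stmt-ValiantsHypothesis-5906` helper.  ALL CREDIT: val-idea-37 g4.  VP ≠ VNP is NOT proved.
-/

noncomputable section

open Classical

-- single-conjunct layout: Sub = Summit, duplicated namespace component intended
set_option linter.dupNamespace false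

namespace Summit.ValiantsHypothesis.ValiantsHypothesis.Theorems.NewtonUnitEquations.TwoProducts.MomentRecord

open scoped BigOperators
open Module Submodule
open Summit.ValiantsHypothesis.ValiantsHypothesis.Theorems.NewtonUnitEquations.TwoProducts.FormalLogLinearisation

variable {m n : ℕ}

/-! ## Record-letter BOUND (second half of the author's §2 + its corollaries; moved here from part 1 for the 400-line cap — texts verbatim) -/

/-- The RECORD LETTERS of a weight: carriers occurring in some record multiset. -/
def recordLetters (α β α' β' : Fin m → Fin n → ℂ) (x : Fin n → Expo) (d : Fin 2 → ℤ) (m' : ℕ) (ξ : Fin 2 → ℝ) :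
    Finset (Fin n) :=
  Finset.univ.filter fun a => ∃ (S : Fin n → ℕ) (k : ℕ), IsRecord α β α' β' x d m' ξ (S, k) ∧ 0 < S a
/-- **RECORD LETTER BOUND** (the former «K1», now a dimension count): at most `4m` record letters per weight
(paper: `4m − 1`; the same set for every weight in a cell of the arrangement `ξ·(x_a − x_b) = 0`), uniformly in `k`, `n`, `t`, `m'`. -/
def RecordLetterBound : Prop :=
  ∀ (m n m' : ℕ) (α β α' β' : Fin m → Fin n → ℂ) (x : Fin n → Expo) (d : Fin 2 → ℤ) (ξ : Fin 2 → ℝ),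
    (∀ i, wt ξ (x i) < 0) → (recordLetters α β α' β' x d m' ξ).card ≤ 4 * m
/-- The pencil space `(Fin m ⊕ Fin m) → Fin 2 → ℂ` has dimension `4m`. -/
theorem finrank_pencilSpace (m : ℕ) : finrank ℂ ((Fin m ⊕ Fin m) → Fin 2 → ℂ) = 4 * m := by
  rw [Module.finrank_pi_fintype]
  simp only [Module.finrank_pi, Fintype.card_fin, Finset.sum_const, Finset.card_univ, Fintype.card_sum,
    smul_eq_mul]
  ring
/-- `WeakRecordLemma → RecordLetterBound` — kernel-checked via `card_le_finrank_of_greedy`. -/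
theorem recordLetterBound_of_weak (hW : WeakRecordLemma) : RecordLetterBound := by
  intro m n m' α β α' β' x d ξ hneg
  have h := card_le_finrank_of_greedy (k := ℂ) (cost ξ x) (pencilVec α β α' β') (oneVec m)
    (recordLetters α β α' β' x d m' ξ) ?_
  · simpa [finrank_pencilSpace] using h
  · intro a ha
    simp only [recordLetters, Finset.mem_filter, Finset.mem_univ, true_and] at ha
    obtain ⟨S, k, hrec, hSa⟩ := ha
    exact hW m n m' α β α' β' x d ξ S k hneg hrec a hSa
/-- Used-letter form of the record letter bound (for (A∘)). -/
def RecordLetterBoundUsed : Prop :=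
  ∀ (m n m' : ℕ) (α β α' β' : Fin m → Fin n → ℂ) (x : Fin n → Expo) (d : Fin 2 → ℤ) (ξ : Fin 2 → ℝ),
    (∀ i, ((∃ j, α j i ≠ 0) ∨ ∃ j, α' j i ≠ 0) → wt ξ (x i) < 0) →
    (recordLetters α β α' β' x d m' ξ).card ≤ 4 * m
/-- `WeakRecordLemmaUsed → RecordLetterBoundUsed`, via `card_le_finrank_of_greedy`. -/
theorem recordLetterBoundUsed_of_weak (hW : WeakRecordLemmaUsed) : RecordLetterBoundUsed := by
  intro m n m' α β α' β' x d ξ hneg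
  have h := card_le_finrank_of_greedy (k := ℂ) (cost ξ x) (pencilVec α β α' β') (oneVec m)
    (recordLetters α β α' β' x d m' ξ) ?_
  · simpa [finrank_pencilSpace] using h
  · intro a ha
    simp only [recordLetters, Finset.mem_filter, Finset.mem_univ, true_and] at ha
    obtain ⟨S, k, hrec, hSa⟩ := ha
    exact hW m n m' α β α' β' x d ξ S k hneg hrec a hSa
/-- COROLLARY (unconditional): at most `4m` record letters per weight (both forms). -/
theorem recordLetterBoundUsed_holds : RecordLetterBoundUsed := recordLetterBoundUsed_of_weak weakRecordLemmaUsed_holds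
/-- All-carriers-negative form of the bound, unconditionally. -/
theorem recordLetterBound_holds : RecordLetterBound := recordLetterBound_of_weak weakRecordLemma_holds

/-! ## 4. The CLASS COUNT (route I-const, last payment): cells of the weight plane × shallow multisets
   ⇒ THE LANDED (A) `MomentRecordLaw` and crit-8's (A∘) `MomentRecordLawUsed` (W4 rev 2/3), PROVED.

For REAL weights `ξ` (both signs of `ξ 1`, and `ξ 1 = 0`) the weak cost order on the carriers is decided by the CELL
`cellOf x ξ` = (signs of `ξ 1`, `ξ 0`; position of `ρ = ξ 0 / ξ 1` against the finite set of critical values `(Q₁ − P₁)/(P₀ − Q₀)`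
of carrier pairs) — at most `32 (n² + 1)` cells (the real/two-signed version of the integer template `DissocCount.stub_dissocCount`
of lead c3's engine).  Per cell, the record letters of ALL weights of the cell and ALL their records satisfy the greedy hypothesis
for ONE representative cost order (`cost_le_cost_iff_of_cellOf_eq`), so they are `≤ 4m` (`card_cellLetters_le`, from
`weakRecordLemmaUsed_holds` + `card_le_finrank_of_greedy`); a record `(S, k)` has `supp S ⊆` letters of its cell,
`Σ_{letters} S ≤ |S| ≤ m` and `k ≤ m`, whence `≤ (m+1) · Σ_{j ≤ m} #piAntidiag(letters, j) ≤ (m+1)² 2^{5m}` candidates per cell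
(stars and bars, `Finset.card_finsuppAntidiag_nat_eq_choose`).  Total `≤ 32 (n²+1) (m+1)² 2^{5m} ≤ 2^{17 m} (t+2)²` for
`1 ≤ m`, `n ≤ 2mt` (`m = 0`: one shallow pair).  The constants `(17, 2)` are lazy; `(9, 2)` is available with
`#cells ≤ 2·C(n,2)+3` and `C(5m−1, m)` (memo §1(3)). -/
section Count

/-- Critical value of an ordered pair of lattice points (a junk value when the abscissae agree — harmless, it only enlarges
the critical set). -/
def critVal (P Q : Expo) : ℝ := (((Q 1 : ℕ) : ℝ) - ((P 1 : ℕ) : ℝ)) / (((P 0 : ℕ) : ℝ) - ((Q 0 : ℕ) : ℝ))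

/-- The finite set of critical values of the carrier configuration `x` (`≤ n²` of them). -/
def critSet (x : Fin n → Expo) : Finset ℝ :=
  (Finset.univ : Finset (Fin n × Fin n)).image fun ab => critVal (x ab.1) (x ab.2)

/-- The CELL of a real weight: the signs of `ξ 1` and `ξ 0`, and the position of `ξ 0 / ξ 1` against the critical values. -/
def cellOf (x : Fin n → Expo) (ξ : Fin 2 → ℝ) : (Bool × Bool × Bool × Bool) × ℕ × Bool :=
  ((decide (0 < ξ 1), decide (ξ 1 < 0), decide (0 < ξ 0), decide (ξ 0 < 0)),
    ((critSet x).filter fun q => q < ξ 0 / ξ 1).card, decide (ξ 0 / ξ 1 ∈ critSet x))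

/-- A finite set containing every cell. -/
def cellSet (x : Fin n → Expo) : Finset ((Bool × Bool × Bool × Bool) × ℕ × Bool) :=
  Finset.univ ×ˢ (Finset.range ((critSet x).card + 1) ×ˢ Finset.univ)

/-- Every weight lies in a listed cell. -/
theorem cellOf_mem_cellSet (x : Fin n → Expo) (ξ : Fin 2 → ℝ) : cellOf x ξ ∈ cellSet x := by
  simp only [cellSet, cellOf, Finset.mem_product, Finset.mem_univ, Finset.mem_range, true_and, and_true]
  exact Nat.lt_succ_of_le (Finset.card_filter_le _ _)

/-- At most `n²` critical values. -/
theorem card_critSet_le (x : Fin n → Expo) : (critSet x).card ≤ n ^ 2 := by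
  refine Finset.card_image_le.trans ?_
  rw [Finset.card_univ, Fintype.card_prod, Fintype.card_fin, sq]

/-- At most `32 (n² + 1)` cells. -/
theorem card_cellSet_le (x : Fin n → Expo) : (cellSet x).card ≤ 32 * (n ^ 2 + 1) := by
  have hQ := card_critSet_le x
  simp only [cellSet, Finset.card_product, Finset.card_univ, Fintype.card_prod, Fintype.card_bool,
    Finset.card_range]
  linarith

/-- `wt ξ P ≤ wt ξ Q` as a comparison of `ξ 0 · (P₀ − Q₀)` with `ξ 1 · (Q₁ − P₁)`. -/
theorem wt_le_wt_iff_sub (ξ : Fin 2 → ℝ) (P Q : Expo) :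
    wt ξ P ≤ wt ξ Q ↔ ξ 0 * (((P 0 : ℕ) : ℝ) - ((Q 0 : ℕ) : ℝ)) ≤ ξ 1 * (((Q 1 : ℕ) : ℝ) - ((P 1 : ℕ) : ℝ)) := by
  simp only [wt]
  constructor <;> intro h <;> linarith

/-- (`ℝ` copy of `DissocCount.lt_of_card_filter_lt_eq`.) -/
theorem lt_of_card_filter_lt_eq (Q : Finset ℝ) (ρ ρ' : ℝ)
    (h : (Q.filter (· < ρ)).card = (Q.filter (· < ρ')).card) {q : ℝ} (hq : q ∈ Q) (hlt : q < ρ) : q < ρ' := by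
  by_contra hn
  have hle : ρ' ≤ q := not_lt.mp hn
  have hsub : Q.filter (· < ρ') ⊆ Q.filter (· < ρ) := by
    intro y hy
    rw [Finset.mem_filter] at hy ⊢
    exact ⟨hy.1, (hy.2.trans_le hle).trans hlt⟩
  have hss : Q.filter (· < ρ') ⊂ Q.filter (· < ρ) :=
    (Finset.ssubset_iff_of_subset hsub).mpr
      ⟨q, Finset.mem_filter.mpr ⟨hq, hlt⟩, fun hx => hn (Finset.mem_filter.mp hx).2⟩
  exact absurd h (Finset.card_lt_card hss).ne'

/-- (`ℝ` copy of `DissocCount.eq_of_cell_eq`.) -/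
theorem eq_of_cell_eq (Q : Finset ℝ) (ρ ρ' : ℝ)
    (h : (Q.filter (· < ρ)).card = (Q.filter (· < ρ')).card) (hρ : ρ ∈ Q) (hρ' : ρ' ∈ Q) : ρ = ρ' := by
  rcases lt_trichotomy ρ ρ' with hlt | heq | hgt
  · exact absurd (lt_of_card_filter_lt_eq Q ρ' ρ h.symm hρ hlt) (lt_irrefl _)
  · exact heq
  · exact absurd (lt_of_card_filter_lt_eq Q ρ ρ' h hρ' hgt) (lt_irrefl _)

/-- (`ℝ` copy of `DissocCount.trichotomy_of_cell_eq`.) Two ratios with the same position `(#{q ∈ Q | q < ρ}, [ρ ∈ Q])`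
sit the same way relative to every `q ∈ Q`. -/
theorem trichotomy_of_cell_eq (Q : Finset ℝ) (ρ ρ' : ℝ)
    (h : (Q.filter (· < ρ)).card = (Q.filter (· < ρ')).card) (hβ : (ρ ∈ Q ↔ ρ' ∈ Q))
    {q : ℝ} (hq : q ∈ Q) : (q < ρ ↔ q < ρ') ∧ (q = ρ ↔ q = ρ') := by
  refine ⟨⟨lt_of_card_filter_lt_eq Q ρ ρ' h hq, lt_of_card_filter_lt_eq Q ρ' ρ h.symm hq⟩, ?_, ?_⟩
  · rintro rfl
    exact eq_of_cell_eq Q q ρ' h hq (hβ.mp hq)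
  · rintro rfl
    exact (eq_of_cell_eq Q ρ q h (hβ.mpr hq) hq).symm

/-- Position of `ρ` against `v / u` decides `ρ u ≤ v`. -/
theorem ratio_le_transfer (ρ ρ' u v : ℝ)
    (H : u ≠ 0 → ((v / u < ρ ↔ v / u < ρ') ∧ (v / u = ρ ↔ v / u = ρ'))) :
    (ρ * u ≤ v ↔ ρ' * u ≤ v) := by
  rcases lt_trichotomy 0 u with hpos | hzero | hneg
  · obtain ⟨h1, -⟩ := H hpos.ne'
    rw [← le_div_iff₀ hpos, ← le_div_iff₀ hpos, ← not_lt, ← not_lt]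
    exact not_congr h1
  · rw [← hzero, mul_zero, mul_zero]
  · obtain ⟨h1, h2⟩ := H hneg.ne
    rw [← div_le_iff_of_neg hneg, ← div_le_iff_of_neg hneg, le_iff_lt_or_eq, le_iff_lt_or_eq, h1, h2]

/-- Position of `ρ` against `v / u` decides `v ≤ ρ u`. -/
theorem ratio_ge_transfer (ρ ρ' u v : ℝ)
    (H : u ≠ 0 → ((v / u < ρ ↔ v / u < ρ') ∧ (v / u = ρ ↔ v / u = ρ'))) :
    (v ≤ ρ * u ↔ v ≤ ρ' * u) := by
  rcases lt_trichotomy 0 u with hpos | hzero | hneg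
  · obtain ⟨h1, h2⟩ := H hpos.ne'
    rw [← div_le_iff₀ hpos, ← div_le_iff₀ hpos, le_iff_lt_or_eq, le_iff_lt_or_eq, h1, h2]
  · rw [← hzero, mul_zero, mul_zero]
  · obtain ⟨h1, -⟩ := H hneg.ne
    rw [← le_div_iff_of_neg hneg, ← le_div_iff_of_neg hneg, ← not_lt, ← not_lt]
    exact not_congr h1

/-- **Same cell ⇒ same weak order of the carrier weights** (real weights, all signs). -/
theorem wt_le_wt_iff_of_cellOf_eq (x : Fin n → Expo) {ξ ξ' : Fin 2 → ℝ} (h : cellOf x ξ = cellOf x ξ') (a b : Fin n) :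
    (wt ξ (x a) ≤ wt ξ (x b) ↔ wt ξ' (x a) ≤ wt ξ' (x b)) := by
  simp only [cellOf, Prod.mk.injEq, decide_eq_decide] at h
  obtain ⟨⟨h1p, h1n, h0p, h0n⟩, hcard, hmem⟩ := h
  rw [wt_le_wt_iff_sub ξ, wt_le_wt_iff_sub ξ']
  set u : ℝ := ((x a 0 : ℕ) : ℝ) - ((x b 0 : ℕ) : ℝ) with hu
  set v : ℝ := ((x b 1 : ℕ) : ℝ) - ((x a 1 : ℕ) : ℝ) with hv
  have hq : critVal (x a) (x b) ∈ critSet x := Finset.mem_image.mpr ⟨(a, b), Finset.mem_univ _, rfl⟩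
  have hcrit : critVal (x a) (x b) = v / u := rfl
  obtain ⟨hlt, heq⟩ := trichotomy_of_cell_eq (critSet x) (ξ 0 / ξ 1) (ξ' 0 / ξ' 1) hcard hmem hq
  rw [hcrit] at hlt heq
  rcases lt_trichotomy 0 (ξ 1) with h1 | h1 | h1
  · -- `ξ 1 > 0`, hence `ξ' 1 > 0`: compare `ρ u ≤ v`
    have key : ∀ η : Fin 2 → ℝ, 0 < η 1 → (η 0 * u ≤ η 1 * v ↔ η 0 / η 1 * u ≤ v) := fun η hη => by
      rw [div_mul_eq_mul_div, div_le_iff₀ hη, mul_comm (η 1) v]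
    rw [key ξ h1, key ξ' (h1p.mp h1)]
    exact ratio_le_transfer _ _ u v fun _ => ⟨hlt, heq⟩
  · -- `ξ 1 = 0`, hence `ξ' 1 = 0`: the sign of `ξ 0` decides
    have hξ1 : ξ 1 = 0 := h1.symm
    have hξ1' : ξ' 1 = 0 := by
      rcases lt_trichotomy (ξ' 1) 0 with hh | hh | hh
      · exact absurd (h1n.mpr hh) (by rw [hξ1]; exact lt_irrefl 0)
      · exact hh
      · exact absurd (h1p.mpr hh) (by rw [hξ1]; exact lt_irrefl 0)
    rw [hξ1, hξ1', zero_mul]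
    have epos : ∀ c : ℝ, 0 < c → (c * u ≤ 0 ↔ u ≤ 0) := fun c hc =>
      ⟨fun h => not_lt.mp fun hu' => (not_lt.mpr h) (mul_pos hc hu'),
        fun h => by simpa using mul_le_mul_of_nonneg_left h hc.le⟩
    have eneg : ∀ c : ℝ, c < 0 → (c * u ≤ 0 ↔ 0 ≤ u) := fun c hc =>
      ⟨fun h => not_lt.mp fun hu' => (not_lt.mpr h) (mul_pos_of_neg_of_neg hc hu'),
        fun h => by simpa using mul_le_mul_of_nonneg_right hc.le h⟩
    rcases lt_trichotomy 0 (ξ 0) with h0 | h0 | h0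
    · rw [epos _ h0, epos _ (h0p.mp h0)]
    · have hξ0 : ξ 0 = 0 := h0.symm
      have hξ0' : ξ' 0 = 0 := by
        rcases lt_trichotomy (ξ' 0) 0 with hh | hh | hh
        · exact absurd (h0n.mpr hh) (by rw [hξ0]; exact lt_irrefl 0)
        · exact hh
        · exact absurd (h0p.mpr hh) (by rw [hξ0]; exact lt_irrefl 0)
      rw [hξ0, hξ0']
    · rw [eneg _ h0, eneg _ (h0n.mp h0)]
  · -- `ξ 1 < 0`, hence `ξ' 1 < 0`: compare `v ≤ ρ u`
    have key : ∀ η : Fin 2 → ℝ, η 1 < 0 → (η 0 * u ≤ η 1 * v ↔ v ≤ η 0 / η 1 * u) := fun η hη => by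
      rw [div_mul_eq_mul_div, le_div_iff_of_neg hη, mul_comm (η 1) v]
    rw [key ξ h1, key ξ' (h1n.mp h1)]
    exact ratio_ge_transfer _ _ u v fun _ => ⟨hlt, heq⟩

/-- One representative cost order per cell (cost form). -/
theorem cost_le_cost_iff_of_cellOf_eq (x : Fin n → Expo) {ξ ξ' : Fin 2 → ℝ} (h : cellOf x ξ = cellOf x ξ')
    (a b : Fin n) : (cost ξ x b ≤ cost ξ x a ↔ cost ξ' x b ≤ cost ξ' x a) := by
  simp only [cost, neg_le_neg_iff]
  exact wt_le_wt_iff_of_cellOf_eq x h a b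

end Count

end Summit.ValiantsHypothesis.ValiantsHypothesis.Theorems.NewtonUnitEquations.TwoProducts.MomentRecord
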